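import Literature.AnabelianGeometry.SemiGraphs.RelativeGluedCoverings
import Literature.AnabelianGeometry.SemiGraphs.TemperedMaximalCompact
import Mathlib.Topology.Algebra.Group.Pointwise
import HarnessLib

/-!
# [SemiAnbd] §2–§3: the relatively glued covering is tempered when the base is

Mochizuki, *Semi-graphs of anabelioids*, Publ. RIMS **42** (2006), §3, Definition 3.5 (ii),
manuscript p. 37 [cite: MochizukiSemiAnbd2006, Def 3.5(ii) p.37] (temperedness tested on each
connected component, [IUTchI] Rmk. 2.5.3 (v)): sequel of `RelativeGluedCoverings.lean`.  The
projection of the relatively glued covering `R.cov → S₀` maps connected components into connected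
components (`sameComponent_proj`), so the component of a point is split by `F₀ × T` with `F₀` a
finite covering splitting the corresponding component of the (tempered) base `S₀` and `T` the
trivialising covering of the approximator (`cov_isTempered`).  Also the preparations for
Theorem 3.7 (ii), same vertex: the structure morphism `RelGluingData.projHom : R.cov ⟶ S₀`, the
naturality of the verticial identifications `S_v ≃ ψ^*X_S` (`IsVerticialHom.exists_equiv_natural`),
and the separation of a point from a compact subset of `π₁^temp(G)` by an open normal subgroup
(`TemperedPiChart.exists_openNormalSubgroup_forall_not_mem`; Rmk. 3.1.2; Hausdorffness of `π₁^temp(G)` is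
`TemperedPiChart.t2Space` of `TemperedMaximalCompact.lean`, seat abc-iut-L3-t11).  Plain bookkeeping.
-/

open CategoryTheory Topology Filter

namespace Literature.AnabelianGeometry.SemiGraphs

universe u

namespace ProfiniteSemiGraph

variable {𝒢 : ProfiniteSemiGraph.{u}}

namespace Approximator

namespace RelGluingData

variable {A : 𝒢.Approximator} {S₀ : CovObj 𝒢} (R : A.RelGluingData S₀)

/-! ### The relatively glued covering is tempered when the base is -/

/-- The projection of the relatively glued covering onto the base, on points.
[cite: MochizukiSemiAnbd2006, Cor 2.7 p.30] -/
def proj : R.cov.Point → S₀.Point :=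
  Sum.elim
    (fun vs => Sum.inl ⟨vs.1, Sum.elim (fun q => q.1.1) (fun q => q.1.1) (show R.VTy vs.1 from vs.2)⟩)
    (fun es => Sum.inr ⟨es.1, (show (S₀.SE es.1).obj.V × R.D.XE es.1 from es.2).1⟩)

/-- The projection maps adjacent points to adjacent points (orbit steps to orbit steps, gluing
steps to gluing steps of the base: `glue_fst`). [cite: MochizukiSemiAnbd2006, Def 3.5(ii) p.37] -/
theorem adj_proj {p q : R.cov.Point} (hpq : R.cov.Adj p q) : S₀.Adj (R.proj p) (R.proj q) := by
  cases hpq with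
  | vertex w γ s =>
    change R.VTy w at s
    rcases s with ⟨⟨y, hy⟩, z⟩ | ⟨⟨y, hy⟩, z⟩
    · exact CovObj.Adj.vertex w γ y
    · exact CovObj.Adj.vertex w γ y
  | edge e γ s =>
    obtain ⟨u, z⟩ := s
    exact CovObj.Adj.edge e γ u
  | glue b w h s =>
    obtain ⟨u, z⟩ := s
    change S₀.Adj (Sum.inr ⟨𝒢.graph.edgeOf b, u⟩)
      (Sum.inl ⟨w, Sum.elim (fun q => q.1.1) (fun q => q.1.1)
        ((R.glue b w h).hom.hom.hom (u, z) : R.VTy w)⟩)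
    rw [R.glue_fst]
    exact CovObj.Adj.glue b w h u

/-- Hence connected components map into connected components. [cite: MochizukiSemiAnbd2006, Def 3.5(ii) p.37] -/
theorem sameComponent_proj {p q : R.cov.Point} (hpq : R.cov.SameComponent p q) :
    S₀.SameComponent (R.proj p) (R.proj q) := by
  induction hpq with
  | rel x y hxy => exact Relation.EqvGen.rel _ _ (R.adj_proj hxy)
  | refl x => exact Relation.EqvGen.refl _
  | symm x y _ ih => exact Relation.EqvGen.symm _ _ ih
  | trans x y z _ _ ih₁ ih₂ => exact Relation.EqvGen.trans _ _ _ ih₁ ih₂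

/-- **The relatively glued covering is tempered when the base is**: the component of a point `p`
is split by `F₀ × T`, where `F₀` is a finite covering splitting the component of the projection of
`p` in `S₀` and `T` is the trivialising covering of the approximator (an element fixing a point of
`F₀` fixes the base coordinates of the component; one fixing a point of `T` maps to `1` in `Π'_c`
and fixes the fibre coordinates). [cite: MochizukiSemiAnbd2006, Def 3.5(ii) p.37] -/
theorem cov_isTempered (hS₀ : S₀.IsTempered) : R.cov.IsTempered := by
  intro p
  obtain ⟨M, hM, hdvd⟩ := A.bounded
  obtain ⟨F₀, hF₀fin, hF₀ne, hF₀⟩ := hS₀ (R.proj p)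
  refine ⟨F₀.prod (A.trivCov hM hdvd), CovObj.prod_isFinite hF₀fin (A.trivCov_isFinite hM hdvd),
    CovObj.prod_hasNonemptyFibres hF₀ne (A.trivCov_hasNonemptyFibres hM hdvd), fun q hpq => ?_⟩
  have hq := hF₀ (R.proj q) (R.sameComponent_proj hpq)
  rcases q with ⟨w, s⟩ | ⟨e, s⟩
  · change R.VTy w at s
    apply CovObj.prod_splitsAt_inl
    intro x t γ hx ht
    have hπ : A.πV w γ = 1 := by
      change (A.πV w γ * t.1, t.2) = t at ht
      exact mul_eq_right.mp (congrArg Prod.fst ht)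
    rcases s with ⟨⟨y, hy⟩, z⟩ | ⟨⟨y, hy⟩, z⟩
    · have h0 : (S₀.SV w).obj.ρ γ y = y := hq x γ hx
      change (Sum.inl ((⟨(S₀.SV w).obj.ρ γ y, (R.O_inv w γ y).mpr hy⟩ :
          {y : (S₀.SV w).obj.V // y ∈ R.O w}), A.πV w γ • z) : R.VTy w) = Sum.inl (⟨y, hy⟩, z)
      exact congrArg Sum.inl (Prod.ext (Subtype.ext h0) (by rw [hπ, one_smul]))
    · have h0 : (S₀.SV w).obj.ρ γ y = y := hq x γ hx
      change (Sum.inr ((⟨(S₀.SV w).obj.ρ γ y, fun h' => hy ((R.O_inv w γ y).mp h')⟩ :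
          {y : (S₀.SV w).obj.V // y ∉ R.O w}), A.πV w γ • z) : R.VTy w) = Sum.inr (⟨y, hy⟩, z)
      exact congrArg Sum.inr (Prod.ext (Subtype.ext h0) (by rw [hπ, one_smul]))
  · obtain ⟨u, z⟩ := s
    change R.D.XE e at z
    apply CovObj.prod_splitsAt_inr
    intro x t γ hx ht
    have hπ : A.πE e γ = 1 := by
      change (A.πE e γ * t.1, t.2) = t at ht
      exact mul_eq_right.mp (congrArg Prod.fst ht)
    have h0 : (S₀.SE e).obj.ρ γ u = u := hq x γ hx
    change (((S₀.SE e).obj.ρ γ u, A.πE e γ • z) : (S₀.SE e).obj.V × R.D.XE e) = (u, z)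
    exact Prod.ext h0 (by rw [hπ, one_smul])

/-- The relatively glued covering as an object of `B^temp(G)`, for a tempered base.
[cite: MochizukiSemiAnbd2006, Cor 2.7 p.30] -/
noncomputable def tcov (hS₀ : S₀.IsTempered) : BTempCat 𝒢 := ⟨R.cov, R.cov_isTempered hS₀⟩


/-- The structure morphism `R.cov ⟶ S₀` of the relatively glued covering (first projections; it
commutes with the gluings by `glue_fst`). [cite: MochizukiSemiAnbd2006, Cor 2.7 p.30] -/
noncomputable def projHom : R.cov ⟶ S₀ where
  fV w := ObjectProperty.homMk
    { hom := TypeCat.ofHom fun s : R.VTy w => Sum.elim (fun q => q.1.1) (fun q => q.1.1) s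
      comm := fun γ => ConcreteCategory.hom_ext _ _ fun s => by
        change R.VTy w at s
        rcases s with ⟨⟨y, hy⟩, z⟩ | ⟨⟨y, hy⟩, z⟩
        · rfl
        · rfl }
  fE e := ObjectProperty.homMk
    { hom := TypeCat.ofHom fun p : (S₀.SE e).obj.V × R.D.XE e => p.1
      comm := fun γ => ConcreteCategory.hom_ext _ _ fun p => rfl }
  comm b w h := by
    refine ObjectProperty.hom_ext _ (Action.hom_ext _ _ (ConcreteCategory.hom_ext _ _ fun p => ?_))
    change (S₀.SE (𝒢.graph.edgeOf b)).obj.V × R.D.XE (𝒢.graph.edgeOf b) at p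
    change (S₀.glue b w h).hom.hom.hom p.1 =
      Sum.elim (fun q => q.1.1) (fun q => q.1.1) ((R.glue b w h).hom.hom.hom p : R.VTy w)
    exact (R.glue_fst b w h p).symm

/-- The projection on a point over `O`. [cite: MochizukiSemiAnbd2006, Cor 2.7 p.30] -/
theorem projHom_fV_inl (w : 𝒢.graph.Vertex) (y : (S₀.SV w).obj.V) (hy : y ∈ R.O w) (z : R.XO w) :
    (R.projHom.fV w).hom.hom (Sum.inl (⟨y, hy⟩, z) : R.VTy w) = y := rfl

/-- The projection on a point off `O`. [cite: MochizukiSemiAnbd2006, Cor 2.7 p.30] -/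
theorem projHom_fV_inr (w : 𝒢.graph.Vertex) (y : (S₀.SV w).obj.V) (hy : y ∉ R.O w) (z : R.D.XV w) :
    (R.projHom.fV w).hom.hom (Sum.inr (⟨y, hy⟩, z) : R.VTy w) = y := rfl

/-- The projection of any point of the `w`-constituent, by cases. [cite: MochizukiSemiAnbd2006, Cor 2.7 p.30] -/
theorem projHom_fV_apply (w : 𝒢.graph.Vertex) (s : R.VTy w) :
    (R.projHom.fV w).hom.hom (s : (R.cov.SV w).obj.V) =
      Sum.elim (fun q => q.1.1) (fun q => q.1.1) s := rfl

end RelGluingData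

end Approximator

/-- **Naturality of the verticial identifications**: for a verticial `ψ : Π_v → π₁^temp(G)` and a
morphism `f : S → S'` of tempered coverings, the identifications `S_v ≃ ψ^*X_S`, `S'_v ≃ ψ^*X_{S'}`
(`X` = chart image) intertwine `f_v` and the chart image of `f`.
[cite: MochizukiSemiAnbd2006, Thm 3.7(i) p.40] -/
theorem IsVerticialHom.exists_equiv_natural {c : TemperedPiChart 𝒢} {v : 𝒢.graph.Vertex}
    {ψ : 𝒢.Gv v →ₜ* c.G} (hψ : IsVerticialHom c v ψ) {S S' : BTempCat 𝒢} (f : S ⟶ S') :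
    ∃ (e : (S.obj.SV v).obj.V ≃ (c.equiv.functor.obj S).obj.V)
      (e' : (S'.obj.SV v).obj.V ≃ (c.equiv.functor.obj S').obj.V),
      (∀ (γ : 𝒢.Gv v) (s : (S.obj.SV v).obj.V),
        e ((S.obj.SV v).obj.ρ γ s) = (c.equiv.functor.obj S).obj.ρ (ψ γ) (e s)) ∧
      (∀ (γ : 𝒢.Gv v) (s : (S'.obj.SV v).obj.V),
        e' ((S'.obj.SV v).obj.ρ γ s) = (c.equiv.functor.obj S').obj.ρ (ψ γ) (e' s)) ∧
      ∀ s : (S.obj.SV v).obj.V,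
        e' ((f.hom.fV v).hom.hom s) = (c.equiv.functor.map f).hom.hom.hom (e s) := by
  obtain ⟨η⟩ := hψ
  let i : S.obj.SV v ≅ (BTemp.res ψ).obj (c.equiv.functor.obj S) :=
    (ObjectProperty.ι _ ⋙ restrictV 𝒢 v).mapIso (c.equiv.unitIso.app S) ≪≫
      η.app (c.equiv.functor.obj S)
  let i' : S'.obj.SV v ≅ (BTemp.res ψ).obj (c.equiv.functor.obj S') :=
    (ObjectProperty.ι _ ⋙ restrictV 𝒢 v).mapIso (c.equiv.unitIso.app S') ≪≫
      η.app (c.equiv.functor.obj S')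
  refine ⟨BTemp.equivOfIso i, BTemp.equivOfIso i', fun γ s => BTemp.equivOfIso_ρ i γ s,
    fun γ s => BTemp.equivOfIso_ρ i' γ s, fun s => ?_⟩
  -- naturality of the unit and of `η`, pointwise
  let u : ∀ T : BTempCat 𝒢, (T.obj.SV v).obj.V →
      (((c.equiv.functor ⋙ c.equiv.inverse).obj T).obj.SV v).obj.V :=
    fun T x => ((c.equiv.unitIso.hom.app T).hom.fV v).hom.hom x
  have h1 : u S' ((f.hom.fV v).hom.hom s) =
      ((c.equiv.inverse.map (c.equiv.functor.map f)).hom.fV v).hom.hom (u S s) := by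
    have := congrArg (fun φ => ((ObjectProperty.ι _ ⋙ restrictV 𝒢 v).map φ).hom.hom s)
      (c.equiv.unitIso.hom.naturality f)
    exact this
  have h2 : (η.hom.app (c.equiv.functor.obj S')).hom.hom
        (((c.equiv.inverse.map (c.equiv.functor.map f)).hom.fV v).hom.hom (u S s)) =
      (c.equiv.functor.map f).hom.hom.hom ((η.hom.app (c.equiv.functor.obj S)).hom.hom (u S s)) := by
    have := congrArg (fun φ => φ.hom.hom (u S s)) (η.hom.naturality (c.equiv.functor.map f))
    exact this
  change (η.hom.app (c.equiv.functor.obj S')).hom.hom (u S' ((f.hom.fV v).hom.hom s)) =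
    (c.equiv.functor.map f).hom.hom.hom ((η.hom.app (c.equiv.functor.obj S)).hom.hom (u S s))
  rw [h1, h2]

namespace TemperedPiChart

/-- In `π₁^temp(G)`, a point outside a compact subset `K` is separated from `K` by an open normal
subgroup of countable index: `g ∉ K · V`, i.e. `k⁻¹ g ∉ V` for all `k ∈ K` (open normal subgroups
form a basis of neighbourhoods of `1`, Rmk. 3.1.2). [cite: MochizukiSemiAnbd2006, Rmk 3.1.2 p.33] -/
theorem exists_openNormalSubgroup_forall_not_mem (c : TemperedPiChart 𝒢) {K : Set c.G}
    (hK : IsCompact K) {g : c.G} (hg : g ∉ K) :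
    ∃ V : OpenNormalSubgroup c.G, Countable (c.G ⧸ V.toSubgroup) ∧ ∀ k ∈ K, k⁻¹ * g ∉ (V : Set c.G) := by
  haveI := c.t2Space
  have hKc : IsClosed K := hK.isClosed
  -- `{x | g x⁻¹ ∉ K}` is an open neighbourhood of `1`
  have hU : {x : c.G | g * x⁻¹ ∈ Kᶜ} ∈ 𝓝 (1 : c.G) := by
    refine (hKc.isOpen_compl.preimage (by fun_prop)).mem_nhds ?_
    simpa using hg
  obtain ⟨V, hVc, hVU⟩ := c.isTempered.basis _ hU
  refine ⟨V, hVc, fun k hk hkV => ?_⟩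
  have := hVU hkV
  simp only [Set.mem_setOf_eq, mul_inv_rev, inv_inv, Set.mem_compl_iff] at this
  exact this (by simpa [mul_assoc] using hk)

end TemperedPiChart

end ProfiniteSemiGraph

end Literature.AnabelianGeometry.SemiGraphs
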